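import Mathlib
import Summits.ValiantsHypothesis.ValiantsHypothesis.Theorems.PermanentalConesPermanentalHyperbolic
import Summits.ValiantsHypothesis.ValiantsHypothesis.Theorems.PermanentalConesPermanentalConeHardSlackAsPermanent
import Summits.ValiantsHypothesis.ValiantsHypothesis.Theorems.PermanentalConesPermanentalConeHardFlagStep

/-!
# `PermanentalConeHard` (stmt-ValiantsHypothesis-8654) — the flag step for the PERMANENTAL cones

Companion of `PermanentalConesPermanentalConeHardFlagStep.lean` (the flag step
`Λ₊₊(Q, 𝟙) = {Q > 0} ∩ Λ₊₊(∂ⱼQ, 𝟙)` for real stable multi-affine forms with nonnegative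
coefficients).  Here we check that the H+ witness polynomials `Q = per[(Y)_{rows<r}; x^{(n-r)}]`,
`Y ≥ 0` entrywise, are in that class — nonnegative coefficients (`coeff_rowPermanent_nonneg`),
multi-affine (`isMultiAffine_rowPermanent`), real stable when nonzero (`isRealStable_rowPermanent`,
the real form of `rowPermanent_zero_or_isUpperHalfPlaneStable`) — and state the flag step for them
(`openHyperbolicityCone_rowPermanent_eq_inter_pderiv`).  Since `∂ⱼQ` is (up to the factor `n - r`)
the next member of the family with the extra constant row `eⱼ` (`sum_C_mul_pderiv_rowPermanent`),
the step iterates inside the family.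
-/

set_option linter.dupNamespace false

noncomputable section

namespace Summit.ValiantsHypothesis.ValiantsHypothesis.Theorems.PermanentalConesPermanentalConeHard

open MvPolynomial Finset
open scoped BigOperators
open Literature.AlgebraicGeometry.HyperbolicPolynomials
open Literature.Combinatorics.StablePolynomials

/-! ### The permanental family is in the class -/

section Permanental

variable {n : ℕ}

/-- Products of polynomials with nonnegative coefficients have nonnegative coefficients.
[folklore] -/
theorem coeff_finset_prod_nonneg {ι τ : Type*} (s : Finset ι) (f : ι → MvPolynomial τ ℝ)
    (hf : ∀ i ∈ s, ∀ m, 0 ≤ (f i).coeff m) : ∀ m, 0 ≤ (∏ i ∈ s, f i).coeff m := by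
  classical
  induction s using Finset.induction_on with
  | empty =>
    intro m
    rw [Finset.prod_empty, MvPolynomial.coeff_one]
    split_ifs <;> norm_num
  | insert a s ha ih =>
    intro m
    rw [Finset.prod_insert ha, MvPolynomial.coeff_mul]
    refine Finset.sum_nonneg fun pq _ => mul_nonneg (hf a (Finset.mem_insert_self a s) _) ?_
    exact ih (fun i hi => hf i (Finset.mem_insert_of_mem hi)) _

/-- **The permanental polynomials have nonnegative coefficients** (for `Y ≥ 0` entrywise).
[folklore] -/
theorem coeff_rowPermanent_nonneg (Y : Fin n → Fin n → ℝ) (hY : ∀ i j, 0 ≤ Y i j) (r : ℕ)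
    (m : Fin n →₀ ℕ) :
    0 ≤ MvPolynomial.coeff m (Matrix.of fun a b : Fin n =>
        if (a : ℕ) < r then C (Y a b) else (X b : MvPolynomial (Fin n) ℝ)).permanent := by
  classical
  unfold Matrix.permanent
  rw [MvPolynomial.coeff_sum]
  refine Finset.sum_nonneg fun σ _ => coeff_finset_prod_nonneg _ _ (fun i _ m' => ?_) m
  simp only [Matrix.of_apply]
  split_ifs
  · rw [MvPolynomial.coeff_C]
    split_ifs
    · exact hY _ _
    · exact le_rfl
  · rw [MvPolynomial.coeff_X]
    split_ifs <;> norm_num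

/-- **The permanental polynomials are multi-affine** (each variable row is the same row `s`, and a
permutation uses every column once). [folklore] -/
theorem isMultiAffine_rowPermanent (Y : Fin n → Fin n → ℝ) (r : ℕ) :
    IsMultiAffine (Matrix.of fun a b : Fin n =>
        if (a : ℕ) < r then C (Y a b) else (X b : MvPolynomial (Fin n) ℝ)).permanent := by
  classical
  intro b
  unfold Matrix.permanent
  refine (MvPolynomial.degreeOf_sum_le _ _ _).trans (Finset.sup_le fun σ _ => ?_)
  refine (MvPolynomial.degreeOf_prod_le _ _ _).trans ?_
  calc ∑ i : Fin n, MvPolynomial.degreeOf b ((Matrix.of fun a b : Fin n =>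
          if (a : ℕ) < r then C (Y a b) else (X b : MvPolynomial (Fin n) ℝ)) (σ i) i)
      ≤ ∑ i : Fin n, (if i = b then 1 else 0) := by
        refine Finset.sum_le_sum fun i _ => ?_
        simp only [Matrix.of_apply]
        split_ifs with h1 h2 h2
        · rw [MvPolynomial.degreeOf_C]; exact zero_le_one
        · rw [MvPolynomial.degreeOf_C]
        · subst h2; rw [MvPolynomial.degreeOf_X_self]
        · rw [MvPolynomial.degreeOf_X_of_ne (Ne.symm h2)]
    _ = 1 := by simp

/-- **The permanental polynomials are real stable** (when nonzero): the real-coefficient form of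
`rowPermanent_zero_or_isUpperHalfPlaneStable`. [cite: BorceaBranden2009, §1] -/
theorem isRealStable_rowPermanent (Y : Fin n → Fin n → ℝ) (hY : ∀ i j, 0 ≤ Y i j) (r : ℕ)
    (hQ : (Matrix.of fun a b : Fin n =>
        if (a : ℕ) < r then C (Y a b) else (X b : MvPolynomial (Fin n) ℝ)).permanent ≠ 0) :
    IsRealStable (Matrix.of fun a b : Fin n =>
        if (a : ℕ) < r then C (Y a b) else (X b : MvPolynomial (Fin n) ℝ)).permanent := by
  classical
  have hmap : MvPolynomial.map (algebraMap ℝ ℂ) (Matrix.of fun a b : Fin n =>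
      if (a : ℕ) < r then C (Y a b) else (X b : MvPolynomial (Fin n) ℝ)).permanent =
      (Matrix.of fun a b : Fin n =>
        if (a : ℕ) < r then C ((Y a b : ℝ) : ℂ) else (X b : MvPolynomial (Fin n) ℂ)).permanent := by
    rw [Theorems.ringHom_map_permanent (MvPolynomial.map (algebraMap ℝ ℂ)) _]
    congr 1
    ext a b
    simp only [Matrix.map_apply, Matrix.of_apply]
    split_ifs
    · rw [MvPolynomial.map_C]; rfl
    · rw [MvPolynomial.map_X]
  unfold IsRealStable
  rw [hmap]
  rcases Theorems.rowPermanent_zero_or_isUpperHalfPlaneStable Y hY r with h0 | hst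
  · refine absurd (MvPolynomial.map_injective (algebraMap ℝ ℂ) (RingHom.injective _) ?_) hQ
    rw [hmap, h0, map_zero]
  · exact hst

/-- **FLAG STEP for the permanental witness cones of `PermanentalConeHard`.**  For `Y ≥ 0`
entrywise, `Q = per[(Y)_{rows<r}; s^{(n-r)}]` with `Q(𝟙) ≠ 0`, and a column `j` on which `Q`
depends (`∂ⱼQ ≠ 0`):  `Λ₊₊(Q, 𝟙) = {x : Q(x) > 0} ∩ Λ₊₊(∂ⱼQ, 𝟙)`. -/
theorem openHyperbolicityCone_rowPermanent_eq_inter_pderiv (Y : Fin n → Fin n → ℝ)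
    (hY : ∀ i j, 0 ≤ Y i j) (r : ℕ) (Q : MvPolynomial (Fin n) ℝ)
    (hQ : Q = (Matrix.of fun a b : Fin n =>
        if (a : ℕ) < r then C (Y a b) else (X b : MvPolynomial (Fin n) ℝ)).permanent)
    {j : Fin n} (hj : pderiv j Q ≠ 0) :
    openHyperbolicityCone Q (fun _ => (1 : ℝ)) =
      {x | 0 < MvPolynomial.eval x Q} ∩ openHyperbolicityCone (pderiv j Q) (fun _ => (1 : ℝ)) := by
  have hQ0 : Q ≠ 0 := fun h => hj (by rw [h, map_zero])
  subst hQ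
  exact openHyperbolicityCone_eq_inter_pderiv (isHomogeneous_rowPermanent Y r)
    (isMultiAffine_rowPermanent Y r) (coeff_rowPermanent_nonneg Y hY r)
    (isRealStable_rowPermanent Y hY r hQ0) hj

end Permanental

/-- **Registered form** (`stub_flagStepRowPermanent` on stmt-ValiantsHypothesis-8654): the flag
step for the permanental witness cones, verbatim signature. -/
theorem stub_flagStepRowPermanent : ∀ (n : ℕ) (Y : Fin n → Fin n → ℝ), (∀ i j, 0 ≤ Y i j) → ∀ (r : ℕ) (Q : MvPolynomial (Fin n) ℝ), Q = (Matrix.of fun a b : Fin n => if (a : ℕ) < r then MvPolynomial.C (Y a b) else MvPolynomial.X b).permanent → ∀ j : Fin n, MvPolynomial.pderiv j Q ≠ 0 → Literature.AlgebraicGeometry.HyperbolicPolynomials.openHyperbolicityCone Q (fun _ => (1 : ℝ)) = {x | 0 < MvPolynomial.eval x Q} ∩ Literature.AlgebraicGeometry.HyperbolicPolynomials.openHyperbolicityCone (MvPolynomial.pderiv j Q) (fun _ => (1 : ℝ)) :=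
  fun _ Y hY r Q hQ _ hj => openHyperbolicityCone_rowPermanent_eq_inter_pderiv Y hY r Q hQ hj

end Summit.ValiantsHypothesis.ValiantsHypothesis.Theorems.PermanentalConesPermanentalConeHard
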